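import Summits.AnomalousDissipation.AnomalousDissipation.Theorems.SawtoothPulseCascadeK1LocalisedCascadeLedgerThinSplit
import Summits.AnomalousDissipation.AnomalousDissipation.Theorems.SawtoothPulseCascadeK1LocalisedCascadeFibreMarginals

/-!
# K1loc, line `Spectral` / thin start — helper: THE FAR CHANNELS OF THE HALF-ITERATE `b_j` (memo v10/v11 file «FarTailB»)

Helper file of the prover lane on the crux `K1LocalisedCascade` (stmt-AnomalousDissipation-19491), route
`SawtoothPulseCascade` (S-D fibre ledger, bookkeeping step B-5).  The class scheme of the ledger restricts every window to
frequencies below a far-tail radius `R_j` and pays the rest by the gradient bound of the iterates; for the iterates `a_n` this is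
`…LedgerThinSplit.tsum_far_iterate_le` (`Σ'[R ≤ |k_l|]‖𝓕a_n‖² ≤ ((1+γ)^{2n}/R)²`).  This file supplies the same for the
HALF-iterates `b_n = a_n ∘ H_n` (the inputs of the V half-steps and the outputs of the H half-steps):
* `tsum_far_halfIterate_le` — `Σ'[R ≤ |k_l|]‖𝓕b_n‖² ≤ ((1+γ)^{2n+1}/R)²` for both axes `l` (`|∂_l b_n| ≤ 2π(1+γ)^{2n+1}`,
  `…IterateGradient.abs_partialDeriv_iterate_le`, and Parseval for `∂_l`, `…FarModes.tsum_far_le_of_abs_partialDeriv_le`);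
* `tsum_far_halfIterate_fst_eq` / `_fst_le` — along the axis PRESERVED by the H half-step the far tail of `b_n` is that of `a_n`:
  `Σ'[R ≤ |k₀|]‖𝓕b_n‖² = Σ'[R ≤ |k₀|]‖𝓕a_n‖² ≤ ((1+γ)^{2n}/R)²` (`…FibreMarginals.tsum_horizontalWeight_hstep`);
* `tsum_far_iterate_succ_snd_eq` — likewise `Σ'[R ≤ |k₁|]‖𝓕a_{n+1}‖² = Σ'[R ≤ |k₁|]‖𝓕b_n‖²` (the V half-step preserves the
  `k₁`-marginals); `tsum_far_halfIterate_snd_le`.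
No definitions; no statement about the crux. [cite: Grafakos2014, Prop. 3.2.6 (8) and Prop. 3.2.7 (3)] [cite: BardosTitiWiedemann2012, Lemma 4]
[problem: turb]
-/

-- `Summit.<Summit>.<Problem>`: single-conjunct summit, the duplicate namespace segment is deliberate.
set_option linter.dupNamespace false

noncomputable section

namespace Summit.AnomalousDissipation.AnomalousDissipation.Theorems.SawtoothPulseCascade.K1Ledger.From

open MeasureTheory Set Filter Topology UnitAddTorus Function
open scoped ENNReal
open Literature.Analysis Literature.Analysis.FunctionSpaces Literature.Analysis.FunctionSpaces.Torus Literature.Analysis.FluidPDE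
open Literature.Analysis.FluidPDE.ShearStage
open Literature.Analysis.FluidPDE.SawtoothCascade Literature.Analysis.FluidPDE.SawtoothCascade.CascadeParams
open Summit.AnomalousDissipation.AnomalousDissipation.Theorems.SawtoothPulseCascade.K1Start
open Summit.AnomalousDissipation.AnomalousDissipation.Theorems.SawtoothPulseCascade.K1Ledger

section Cascade

variable (P : CascadeParams)

/-- **The far channels of the half-iterate `b_n = a_n ∘ H_n`**: for the inviscid iterate of the datum (`γ ≥ 0`) and any `R > 0`,
`Σ'[R ≤ |k_l|]·‖𝓕b_n(k)‖² ≤ ((1+γ)^{2n+1}/R)²` for both axes `l` (`|∂_l b_n| ≤ 2π(1+γ)^{2n+1}` and Parseval for `∂_l`).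
[cite: Grafakos2014, Prop. 3.2.6 (8) and Prop. 3.2.7 (3)] [cite: BardosTitiWiedemann2012, Lemma 4] -/
theorem tsum_far_halfIterate_le (hγ : 0 ≤ P.γ) (hδ₀ : 0 < P.δ₀) (hd : 0 < P.d)
    (a b : ℕ → UnitAddTorus (Fin 2) → ℝ) (has : ∀ j, IsSmooth (a j)) (h0 : a 0 = datum)
    (hb : ∀ j, b j = a j ∘ shearMap 0 1 (amp ⟨P.U j, P.U_periodic j, P.contDiff_U (P.δ_pos hδ₀ hd j)⟩ P.γ))
    (hab : ∀ j, a (j + 1) = b j ∘ shearMap 1 0 (amp ⟨P.U j, P.U_periodic j, P.contDiff_U (P.δ_pos hδ₀ hd j)⟩ P.γ))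
    (n : ℕ) (l : Fin 2) {R : ℝ} (hR : 0 < R) :
    ∑' k : Fin 2 → ℤ, (if R ≤ |((k l : ℤ) : ℝ)| then (1 : ℝ) else 0) * ‖mFourierCoeff (fun x => (b n x : ℂ)) k‖ ^ 2 ≤
      ((1 + P.γ) ^ (2 * n + 1) / R) ^ 2 := by
  have hG : ∀ l x, |partialDeriv l (a 0) x| ≤ 2 * Real.pi := fun l x => by rw [h0]; exact abs_partialDeriv_datum_le l x
  have hD := (abs_partialDeriv_iterate_le P hγ hδ₀ hd a b has hb hab Real.two_pi_pos.le hG n).2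
  have hbs : IsSmooth (b n) := by rw [hb n]; exact (has n).comp_shearMap _ _ _
  refine (tsum_far_le_of_abs_partialDeriv_le hbs l hR (D := 2 * Real.pi * (1 + P.γ) ^ (2 * n + 1)) (fun x => hD l x)).trans
    (le_of_eq ?_)
  congr 1
  field_simp

/-- **Along `e₀` the far tail of `b_n` IS that of `a_n`** (the H half-step `b_n = a_n ∘ shearMap 0 1 φ` preserves the
`k₀`-marginals of the spectrum): `Σ'[R ≤ |k₀|]‖𝓕b_n‖² = Σ'[R ≤ |k₀|]‖𝓕a_n‖²`. [cite: Grafakos2014, Prop. 3.2.7 (3)] -/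
theorem tsum_far_halfIterate_fst_eq (hδ₀ : 0 < P.δ₀) (hd : 0 < P.d)
    (a b : ℕ → UnitAddTorus (Fin 2) → ℝ) (has : ∀ j, IsSmooth (a j))
    (hb : ∀ j, b j = a j ∘ shearMap 0 1 (amp ⟨P.U j, P.U_periodic j, P.contDiff_U (P.δ_pos hδ₀ hd j)⟩ P.γ))
    (n : ℕ) (R : ℝ) :
    ∑' k : Fin 2 → ℤ, (if R ≤ |((k 0 : ℤ) : ℝ)| then (1 : ℝ) else 0) * ‖mFourierCoeff (fun x => (b n x : ℂ)) k‖ ^ 2 =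
      ∑' k : Fin 2 → ℤ, (if R ≤ |((k 0 : ℤ) : ℝ)| then (1 : ℝ) else 0) * ‖mFourierCoeff (fun x => (a n x : ℂ)) k‖ ^ 2 :=
  tsum_horizontalWeight_hstep (has n).continuous _ (hb n) (w := fun m : ℤ => if R ≤ |((m : ℤ) : ℝ)| then (1 : ℝ) else 0)
    (C := 1) fun m => by split_ifs <;> simp

/-- **Along `e₀` the far tail of `b_n` is at most `((1+γ)^{2n}/R)²`** (marginal invariance + `…LedgerThinSplit.tsum_far_iterate_le`;
one power of `1+γ` better than the gradient bound of `b_n`). [cite: Grafakos2014, Prop. 3.2.6 (8) and Prop. 3.2.7 (3)] -/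
theorem tsum_far_halfIterate_fst_le (hγ : 0 ≤ P.γ) (hδ₀ : 0 < P.δ₀) (hd : 0 < P.d)
    (a b : ℕ → UnitAddTorus (Fin 2) → ℝ) (has : ∀ j, IsSmooth (a j)) (h0 : a 0 = datum)
    (hb : ∀ j, b j = a j ∘ shearMap 0 1 (amp ⟨P.U j, P.U_periodic j, P.contDiff_U (P.δ_pos hδ₀ hd j)⟩ P.γ))
    (hab : ∀ j, a (j + 1) = b j ∘ shearMap 1 0 (amp ⟨P.U j, P.U_periodic j, P.contDiff_U (P.δ_pos hδ₀ hd j)⟩ P.γ))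
    (n : ℕ) {R : ℝ} (hR : 0 < R) :
    ∑' k : Fin 2 → ℤ, (if R ≤ |((k 0 : ℤ) : ℝ)| then (1 : ℝ) else 0) * ‖mFourierCoeff (fun x => (b n x : ℂ)) k‖ ^ 2 ≤
      ((1 + P.γ) ^ (2 * n) / R) ^ 2 := by
  rw [tsum_far_halfIterate_fst_eq P hδ₀ hd a b has hb n R]
  exact tsum_far_iterate_le P hγ hδ₀ hd a b has h0 hb hab n 0 hR

/-- **Along `e₁` the far tail of `a_{n+1}` is that of `b_n`** (the V half-step `a_{n+1} = b_n ∘ shearMap 1 0 φ` preserves the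
`k₁`-marginals): `Σ'[R ≤ |k₁|]‖𝓕a_{n+1}‖² = Σ'[R ≤ |k₁|]‖𝓕b_n‖²`. [cite: Grafakos2014, Prop. 3.2.7 (3)] -/
theorem tsum_far_iterate_succ_snd_eq (hδ₀ : 0 < P.δ₀) (hd : 0 < P.d)
    (a b : ℕ → UnitAddTorus (Fin 2) → ℝ) (has : ∀ j, IsSmooth (a j))
    (hb : ∀ j, b j = a j ∘ shearMap 0 1 (amp ⟨P.U j, P.U_periodic j, P.contDiff_U (P.δ_pos hδ₀ hd j)⟩ P.γ))
    (hab : ∀ j, a (j + 1) = b j ∘ shearMap 1 0 (amp ⟨P.U j, P.U_periodic j, P.contDiff_U (P.δ_pos hδ₀ hd j)⟩ P.γ))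
    (n : ℕ) (R : ℝ) :
    ∑' k : Fin 2 → ℤ, (if R ≤ |((k 1 : ℤ) : ℝ)| then (1 : ℝ) else 0) * ‖mFourierCoeff (fun x => (a (n + 1) x : ℂ)) k‖ ^ 2 =
      ∑' k : Fin 2 → ℤ, (if R ≤ |((k 1 : ℤ) : ℝ)| then (1 : ℝ) else 0) * ‖mFourierCoeff (fun x => (b n x : ℂ)) k‖ ^ 2 := by
  have hbs : IsSmooth (b n) := by rw [hb n]; exact (has n).comp_shearMap _ _ _
  exact tsum_verticalWeight_vstep hbs.continuous _ (hab n) (w := fun m : ℤ => if R ≤ |((m : ℤ) : ℝ)| then (1 : ℝ) else 0)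
    (C := 1) fun m => by split_ifs <;> simp

/-- **Along `e₁` the far tail of `b_n` is that of `a_{n+1}`, hence `≤ ((1+γ)^{2(n+1)}/R)²`** — and, combined with
`tsum_far_halfIterate_le`, `≤ ((1+γ)^{2n+1}/R)²`; both forms are recorded. [cite: Grafakos2014, Prop. 3.2.6 (8) and Prop. 3.2.7 (3)] -/
theorem tsum_far_halfIterate_snd_le (hγ : 0 ≤ P.γ) (hδ₀ : 0 < P.δ₀) (hd : 0 < P.d)
    (a b : ℕ → UnitAddTorus (Fin 2) → ℝ) (has : ∀ j, IsSmooth (a j)) (h0 : a 0 = datum)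
    (hb : ∀ j, b j = a j ∘ shearMap 0 1 (amp ⟨P.U j, P.U_periodic j, P.contDiff_U (P.δ_pos hδ₀ hd j)⟩ P.γ))
    (hab : ∀ j, a (j + 1) = b j ∘ shearMap 1 0 (amp ⟨P.U j, P.U_periodic j, P.contDiff_U (P.δ_pos hδ₀ hd j)⟩ P.γ))
    (n : ℕ) {R : ℝ} (hR : 0 < R) :
    ∑' k : Fin 2 → ℤ, (if R ≤ |((k 1 : ℤ) : ℝ)| then (1 : ℝ) else 0) * ‖mFourierCoeff (fun x => (b n x : ℂ)) k‖ ^ 2 ≤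
      ((1 + P.γ) ^ (2 * n + 1) / R) ^ 2 :=
  tsum_far_halfIterate_le P hγ hδ₀ hd a b has h0 hb hab n 1 hR

end Cascade

end Summit.AnomalousDissipation.AnomalousDissipation.Theorems.SawtoothPulseCascade.K1Ledger.From
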